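import Literature.AlgebraicGeometry.Resolution.AlterationsNormalProjectiveStepLeaves
import HarnessLib

/-!
# De Jong 1996, 4.11–4.22 (`DeJong1996ReductionToSemiStablePair`) from its open leaves

Topic: `Literature/AlgebraicGeometry/Resolution`. Bookkeeping (pure composition, no new named
fact, no new definition) for the named fact `DeJong1996ReductionToSemiStablePair` of
`AlterationsSemiStable.lean` — de Jong 1996, 4.11–4.22: over an algebraically closed field `k`,
given Thm. 4.1 with its generically-étale clause in dimension `≤ d`, Thm. 4.1 with the clause for
a normal projective pair `(X, Z)` of dimension `d + 1` follows from Thm. 4.1 with the clause for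
every pair in Situation 4.23 over `k` of the same dimension.

That fact is the first half of the cut of 4.11–4.28 (`DeJong1996NormalProjectiveStep`) at the
point where the printed text itself restarts ("we reduce to the situation described in 4.23
below. […] **4.23. Situation.**", p. 75); it is an INTERIOR node of the decomposition of the
printed proof already in the tree, and everything between it and the current leaves is PROVED:

* `DeJong1996ReductionToSemiStablePair.of_fibration_of_fibrationToSemiStablePair`
  (`AlterationsThreeBlocks.lean`): 4.11–4.22 from 4.11–4.12 (`DeJong1996FibrationReduction`) and
  4.13–4.22 (`DeJong1996FibrationToSemiStablePair`), by 4.4 and 2.20;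
* `DeJong1996FibrationReduction.of_openLeaves` (`AlterationsNormalProjectiveStepLeaves.lean`):
  4.11–4.12 from SIX open leaves — the generic projection of Lemma 4.11 normalised at the vertex
  and the blow-up of the vertex (`DeJong1996Lemma411VertexChoice`,
  `DeJong1996VertexBlowupProjection`), Zariski's connectedness theorem for the Stein
  factorisation (`steinFactorization_geometricallyConnected`, Stacks 03H2), finiteness and
  étaleness of its finite part in 4.12 (`DeJong1996SteinFactorizationEtale`), and `π₁(ℙ^d) = 0`
  through `π₁(ℙ¹) = 0` and the connectedness of hyperplane sections of étale covers
  (`ProjectiveLineSimplyConnected`, `EtaleCoverHyperplaneSectionConnected`); the blow-up of `X`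
  in `π⁻¹(p)`, the fibre dimension, the density of the smooth locus, 2.8 and the projectivity of
  blow-ups are discharged (`DeJong1996Lemma411Blowup_holds`,
  `DeJong1996Lemma411FibreDimension_holds`, `DeJong1996Lemma411SmoothLocusDense_holds`,
  `DeJong1996SmoothOverOpen_holds`, `BlowupProjectiveOverField_holds`);
* `DeJong1996FibrationToSemiStablePair.of_printedLeaves` (`AlterationsStrongAlgClosedLeaves.lean`):
  4.13–4.22 from FOUR open leaves — the hyperplane multisection of the proof of Lemma 4.13
  (`DeJong1996MultisectionHyperplane`), Galois normalisation 4.16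
  (`DeJong1996GaloisNormalization`), the stable extension through the level-`ℓ` moduli scheme
  4.17/2.24 (`DeJong1996StableExtension`) and the extension of `β : 𝒞 ⇢ X` after a modification
  of the base 4.18–4.21/2.19 (`DeJong1996RationalMapExtension`); the local and generically-étale
  parts of 4.13, the Noetherian induction of 4.13, 4.14–4.15 (strict transforms) and 4.22
  (pull-back of the family, Liu 4.3.8) are discharged (`DeJong1996MultisectionEtaleNhd_holds`,
  `DeJong1996MultisectionGenericallyEtale_holds`, `DeJong1996StrictTransform_holds`,
  `DeJong1996PreSemiStablePairToSemiStablePair_holds`).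

Hence the single declaration below: **`DeJong1996ReductionToSemiStablePair` from the TEN named
facts currently open below it**, each an existing declaration with its own locator. Its discharge
`DeJong1996ReductionToSemiStablePair_holds` is exactly this term applied to the ten discharges
`…_holds` once they land — no further decomposition of this node and no new named fact is
needed (D-0026 review of the cut, 2026-08-15: the statement was checked against the held copy of
the source, pp. 67–75, and is the printed block 4.11–4.22 as stated). The node is not on the
critical path of its parent either: `DeJong1996NormalProjectiveStep.of_openLeaves` consumes the
same ten leaves (and four more for 4.23–4.28) directly.

## Sources

* A. J. de Jong, *Smoothness, semi-stability and alterations*, Publ. Math. IHÉS 83 (1996) 51–93: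
  Lemma 4.11 and 4.12 (pp. 67–69), Lemma 4.13–4.22 (pp. 69–75), Situation 4.23 (p. 75); 2.8,
  2.18–2.20, 2.24, 4.4, 4.9.
-/

noncomputable section

open CategoryTheory AlgebraicGeometry

namespace Literature.AlgebraicGeometry.Resolution

universe u

open Literature.AlgebraicGeometry.Morphisms Literature.AlgebraicGeometry.FundamentalGroup

/-- **`DeJong1996ReductionToSemiStablePair` — de Jong 1996, 4.11–4.22 — from the ten named facts
currently open below it**: six for 4.11–4.12 (the generic projection of Lemma 4.11 normalised at
the vertex and the blow-up of the vertex; Zariski's connectedness theorem for the Stein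
factorisation, finiteness-and-étaleness of its finite part, `π₁(ℙ¹) = 0` and the connectedness
of hyperplane sections of étale covers) and four for 4.13–4.22 (the hyperplane multisection
4.13, Galois normalisation 4.16, the stable extension through the level-`ℓ` moduli scheme
4.17/2.24, the extension of `β : 𝒞 ⇢ X` after a modification of the base 4.18–4.21/2.19);
everything else of 4.11–4.22 is proved in the tree (module docstring). The discharge of the
fact is this term fed with the ten discharges. [cite: DeJong1996, 4.11–4.22, pp. 67–75] -/
theorem DeJong1996ReductionToSemiStablePair.of_openLeaves
    -- 4.11–4.12
    (hV : DeJong1996VertexBlowupProjection.{u}) (hC : DeJong1996Lemma411VertexChoice.{u})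
    (hZ : steinFactorization_geometricallyConnected.{u}) (hE : DeJong1996SteinFactorizationEtale.{u})
    (hP1 : ProjectiveLineSimplyConnected.{u}) (hH : EtaleCoverHyperplaneSectionConnected.{u})
    -- 4.13–4.22
    (h13 : DeJong1996MultisectionHyperplane.{u}) (h16 : DeJong1996GaloisNormalization.{u})
    (h17 : DeJong1996StableExtension.{u}) (h18 : DeJong1996RationalMapExtension.{u}) :
    DeJong1996ReductionToSemiStablePair.{u} :=
  DeJong1996ReductionToSemiStablePair.of_fibration_of_fibrationToSemiStablePair
    (DeJong1996FibrationReduction.of_openLeaves hV hC hZ hE hP1 hH)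
    (DeJong1996FibrationToSemiStablePair.of_printedLeaves h13 h16 h17 h18)

/-- The same ten leaves, split as the text splits 4.11–4.22 at 4.12: the first block alone
(`DeJong1996FibrationReduction`, 4.11–4.12) and the four leaves of 4.13–4.22 already give the
node. [cite: DeJong1996, 4.11–4.22, pp. 67–75] -/
theorem DeJong1996ReductionToSemiStablePair.of_fibration_of_printedLeaves
    (h₁ : DeJong1996FibrationReduction.{u})
    (h13 : DeJong1996MultisectionHyperplane.{u}) (h16 : DeJong1996GaloisNormalization.{u})
    (h17 : DeJong1996StableExtension.{u}) (h18 : DeJong1996RationalMapExtension.{u}) :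
    DeJong1996ReductionToSemiStablePair.{u} :=
  DeJong1996ReductionToSemiStablePair.of_fibration_of_fibrationToSemiStablePair h₁
    (DeJong1996FibrationToSemiStablePair.of_printedLeaves h13 h16 h17 h18)

end Literature.AlgebraicGeometry.Resolution

end
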